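import Summits.AtomisticToContinuum.Crystallization.Theorems.HullExactificationCascadeHullGoodEverywhereGoodAPI
import Literature.MathematicalPhysics.StatisticalMechanics.LocalMatchingCompactness

/-!
# `HullGoodEverywhere` (route `HullExactificationCascade`, item D): relative denseness

An everywhere-good, `δ`-separated, non-empty `S ⊆ ℝ³` whose local scales are bounded by `R₀` is
relatively dense with constant `4 R₀` (`hge_relDense`).  Ingredient: the two kissing patterns see
every direction — for every `u` some pattern vector `v` has `‖u‖ ≤ 5 ⟪u, v⟫`
(`hge_fcc_cover`, `hge_hcp_cover`, by sign/coordinate bookkeeping on the integer models); hence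
from the closest point `y ∈ S` to a far point `p`, the neighbour of `y` in the direction of `p`
is closer to `p`.
-/

noncomputable section

namespace Summit.AtomisticToContinuum.Crystallization.Theorems

open Literature.MathematicalPhysics.StatisticalMechanics Literature.Geometry.DiscreteGeometry
open Filter Topology Metric RealInnerProductSpace

/-! ## Coordinates -/

/-- `⟪u, intVec w⟫ = u₀ w₀ + u₁ w₁ + u₂ w₂`. [folklore] -/
theorem hge_inner_intVec (u : (EuclideanSpace ℝ (Fin 3))) (w : Fin 3 → ℤ) :
    ⟪u, intVec w⟫ = u 0 * w 0 + u 1 * w 1 + u 2 * w 2 := by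
  simp [PiLp.inner_apply, Fin.sum_univ_three, intVec_apply, mul_comm]

/-- `‖u‖² = u₀² + u₁² + u₂²`. [folklore] -/
theorem hge_norm_sq (u : (EuclideanSpace ℝ (Fin 3))) : ‖u‖ ^ 2 = u 0 ^ 2 + u 1 ^ 2 + u 2 ^ 2 := by
  rw [EuclideanSpace.norm_sq_eq, Fin.sum_univ_three]
  simp [Real.norm_eq_abs, sq_abs]

/-- From `5 ⟪u, w/√N⟫ < ‖u‖` to `5 ⟪u, w⟫ < √N ‖u‖` in coordinates. [folklore] -/
theorem hge_cover_aux {N : ℕ} (hN : 0 < N) {u : (EuclideanSpace ℝ (Fin 3))} {w : Fin 3 → ℤ}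
    (h : 5 * ⟪u, (Real.sqrt N)⁻¹ • intVec w⟫ < ‖u‖) :
    5 * (u 0 * w 0 + u 1 * w 1 + u 2 * w 2) < Real.sqrt N * ‖u‖ := by
  rw [real_inner_smul_right, hge_inner_intVec] at h
  have hs : 0 < Real.sqrt N := Real.sqrt_pos.2 (by exact_mod_cast hN)
  calc 5 * (u 0 * w 0 + u 1 * w 1 + u 2 * w 2)
      = Real.sqrt N * (5 * ((Real.sqrt N)⁻¹ * (u 0 * w 0 + u 1 * w 1 + u 2 * w 2))) := by
        field_simp
    _ < Real.sqrt N * ‖u‖ := mul_lt_mul_of_pos_left h hs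

/-! ## The two patterns see every direction -/

/-- Instance of `hge_cover_aux` for an explicit integer vector `![a, b, c]`. [folklore] -/
theorem hge_cover_aux3 {N : ℕ} (hN : 0 < N) {u : EuclideanSpace ℝ (Fin 3)} {a b c : ℤ}
    (h : 5 * ⟪u, (Real.sqrt N)⁻¹ • intVec ![a, b, c]⟫ < ‖u‖) :
    5 * (u 0 * a + u 1 * b + u 2 * c) < Real.sqrt N * ‖u‖ := by
  have := hge_cover_aux hN h
  have e0 : (![a, b, c] : Fin 3 → ℤ) 0 = a := rfl
  have e1 : (![a, b, c] : Fin 3 → ℤ) 1 = b := rfl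
  have e2 : (![a, b, c] : Fin 3 → ℤ) 2 = c := rfl
  rwa [e0, e1, e2] at this

/-- **The cuboctahedron sees every direction**: for every `u ∈ ℝ³` some fcc pattern vector `v`
has `‖u‖ ≤ 5 ⟪u, v⟫`. [folklore] -/
theorem hge_fcc_cover (u : EuclideanSpace ℝ (Fin 3)) :
    ∃ v ∈ fccKissingPattern, ‖u‖ ≤ 5 * ⟪u, v⟫ := by
  by_contra hcon
  push Not at hcon
  have key : ∀ a b c : ℤ, ![a, b, c] ∈ fccInt →
      5 * (u 0 * a + u 1 * b + u 2 * c) < Real.sqrt (2 : ℕ) * ‖u‖ :=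
    fun a b c hw => hge_cover_aux3 two_pos (hcon _ (by
      unfold fccKissingPattern scaledPattern
      exact Finset.mem_image_of_mem _ hw))
  set L : ℝ := Real.sqrt (2 : ℕ) * ‖u‖ with hL
  have hL2 : L ^ 2 = 2 * (u 0 ^ 2 + u 1 ^ 2 + u 2 ^ 2) := by
    rw [hL, mul_pow, Real.sq_sqrt (by norm_num), hge_norm_sq]; norm_num
  have h1 := key 1 1 0 (by decide)
  have h2 := key 1 (-1) 0 (by decide)
  have h3 := key (-1) 1 0 (by decide)
  have h4 := key (-1) (-1) 0 (by decide)
  have h5 := key 1 0 1 (by decide)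
  have h6 := key 1 0 (-1) (by decide)
  have h7 := key (-1) 0 1 (by decide)
  have h8 := key (-1) 0 (-1) (by decide)
  have h9 := key 0 1 1 (by decide)
  have h10 := key 0 1 (-1) (by decide)
  have h11 := key 0 (-1) 1 (by decide)
  have h12 := key 0 (-1) (-1) (by decide)
  push_cast at h1 h2 h3 h4 h5 h6 h7 h8 h9 h10 h11 h12
  have ha1 : 5 * u 0 < L := by linarith
  have ha2 : -(5 * u 0) < L := by linarith
  have hb1 : 5 * u 1 < L := by linarith
  have hb2 : -(5 * u 1) < L := by linarith
  have hc1 : 5 * u 2 < L := by linarith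
  have hc2 : -(5 * u 2) < L := by linarith
  have ha : 25 * u 0 ^ 2 < L ^ 2 := by nlinarith [ha1, ha2]
  have hb : 25 * u 1 ^ 2 < L ^ 2 := by nlinarith [hb1, hb2]
  have hc : 25 * u 2 ^ 2 < L ^ 2 := by nlinarith [hc1, hc2]
  nlinarith [sq_nonneg (u 0), sq_nonneg (u 1), sq_nonneg (u 2)]

/-- **The anticuboctahedron sees every direction**: for every `u ∈ ℝ³` some hcp pattern vector
`v` has `‖u‖ ≤ 5 ⟪u, v⟫`. [folklore] -/
theorem hge_hcp_cover (u : EuclideanSpace ℝ (Fin 3)) :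
    ∃ v ∈ hcpKissingPattern, ‖u‖ ≤ 5 * ⟪u, v⟫ := by
  by_contra hcon
  push Not at hcon
  have key : ∀ a b c : ℤ, ![a, b, c] ∈ hcpInt →
      5 * (u 0 * a + u 1 * b + u 2 * c) < Real.sqrt (18 : ℕ) * ‖u‖ :=
    fun a b c hw => hge_cover_aux3 (by norm_num) (hcon _ (by
      unfold hcpKissingPattern scaledPattern
      exact Finset.mem_image_of_mem _ hw))
  set L : ℝ := Real.sqrt (18 : ℕ) * ‖u‖ with hL
  have hL2 : L ^ 2 = 18 * (u 0 ^ 2 + u 1 ^ 2 + u 2 ^ 2) := by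
    rw [hL, mul_pow, Real.sq_sqrt (by norm_num), hge_norm_sq]; norm_num
  have h1 := key 3 (-3) 0 (by decide)
  have h2 := key (-3) 3 0 (by decide)
  have h3 := key 3 0 (-3) (by decide)
  have h4 := key (-3) 0 3 (by decide)
  have h5 := key 0 3 (-3) (by decide)
  have h6 := key 0 (-3) 3 (by decide)
  have h7 := key 3 3 0 (by decide)
  have h8 := key 3 0 3 (by decide)
  have h9 := key 0 3 3 (by decide)
  have h10 := key (-1) (-1) (-4) (by decide)
  have h11 := key (-1) (-4) (-1) (by decide)
  have h12 := key (-4) (-1) (-1) (by decide)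
  push_cast at h1 h2 h3 h4 h5 h6 h7 h8 h9 h10 h11 h12
  -- `10 |s| < L` for `s = u₀ + u₁ + u₂`, `15 |uᵢ - uⱼ| < L`, hence `90 |uᵢ| < 7 L`
  have ha1 : 90 * u 0 < 7 * L := by linarith
  have ha2 : -(90 * u 0) < 7 * L := by linarith
  have hb1 : 90 * u 1 < 7 * L := by linarith
  have hb2 : -(90 * u 1) < 7 * L := by linarith
  have hc1 : 90 * u 2 < 7 * L := by linarith
  have hc2 : -(90 * u 2) < 7 * L := by linarith
  have ha : 8100 * u 0 ^ 2 < 49 * L ^ 2 := by nlinarith [ha1, ha2]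
  have hb : 8100 * u 1 ^ 2 < 49 * L ^ 2 := by nlinarith [hb1, hb2]
  have hc : 8100 * u 2 ^ 2 < 49 * L ^ 2 := by nlinarith [hc1, hc2]
  nlinarith [sq_nonneg (u 0), sq_nonneg (u 1), sq_nonneg (u 2)]

/-- The covering property transported by a linear isometry `A` of `ℝ³`: for every `u` some
pattern vector `v` has `‖u‖ ≤ 5 ⟪u, A v⟫` (apply the property to `A⁻¹ u`; `A` is onto since
`ℝ³` is finite-dimensional). [folklore] -/
theorem hge_cover_isometry {P : Finset (EuclideanSpace ℝ (Fin 3))} (hP : ∀ u : (EuclideanSpace ℝ (Fin 3)), ∃ v ∈ P, ‖u‖ ≤ 5 * ⟪u, v⟫)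
    (A : (EuclideanSpace ℝ (Fin 3)) →ₗᵢ[ℝ] (EuclideanSpace ℝ (Fin 3))) (u : (EuclideanSpace ℝ (Fin 3))) : ∃ v ∈ P, ‖u‖ ≤ 5 * ⟪u, A v⟫ := by
  set A' : (EuclideanSpace ℝ (Fin 3)) ≃ₗᵢ[ℝ] (EuclideanSpace ℝ (Fin 3)) := A.toLinearIsometryEquiv rfl with hA'
  obtain ⟨v, hv, h⟩ := hP (A'.symm u)
  refine ⟨v, hv, ?_⟩
  have h1 : ⟪u, A v⟫ = ⟪A'.symm u, v⟫ := by
    conv_lhs => rw [← A'.apply_symm_apply u]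
    rw [← LinearIsometry.toLinearIsometryEquiv_apply A rfl, ← hA', A'.inner_map_map]
  rw [h1, ← A'.symm.norm_map u]
  exact h

/-! ## Relative denseness -/

/-- **One step closer.** If `y ∈ S` is `PatternGood P R₀` in the `δ`-separated `S` for a pattern
`P` of unit vectors seeing every direction, and `dist y p > 4 R₀`, then some point of `S` is
strictly closer to `p` than `y`. [folklore] -/
theorem hge_exists_closer {P : Finset (EuclideanSpace ℝ (Fin 3))} (hP1 : ∀ v ∈ P, ‖v‖ = 1) (hPne : P.Nonempty)
    (hP : ∀ u : (EuclideanSpace ℝ (Fin 3)), ∃ v ∈ P, ‖u‖ ≤ 5 * ⟪u, v⟫) {S : Set (EuclideanSpace ℝ (Fin 3))} {δ R₀ : ℝ} (hδ : 0 < δ)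
    (hsep : ∀ p ∈ S, ∀ q ∈ S, p ≠ q → δ ≤ dist p q) {y : (EuclideanSpace ℝ (Fin 3))} (hy : y ∈ S)
    (hgood : PatternGood P R₀ S y) {p : (EuclideanSpace ℝ (Fin 3))} (hfar : 4 * R₀ < dist y p) :
    ∃ z ∈ S, dist z p < dist y p := by
  obtain ⟨d, A, q, -, hδd, hdR, hq, -, -, -, -⟩ := hgood.exists_data hδ hP1 hPne hsep hy
  have hd0 : 0 < d := hδ.trans_le hδd
  obtain ⟨v, hv, hcov⟩ := hge_cover_isometry hP A (p - y)
  refine ⟨q ⟨v, hv⟩, (hq ⟨v, hv⟩).1, ?_⟩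
  set m : (EuclideanSpace ℝ (Fin 3)) := q ⟨v, hv⟩ - y with hm
  set r : ℝ := dist y p with hr
  have hr' : ‖p - y‖ = r := by rw [hr, dist_comm, dist_eq_norm]
  -- `‖m - d • A v‖ ≤ d / 20` and `‖m‖ ≤ 21 d / 20`
  have hmA : ‖m - d • A v‖ ≤ d / 20 := by
    have h := (hq ⟨v, hv⟩).2.2.2.1
    rw [dist_eq_norm] at h
    have e : m - d • A v = d • (d⁻¹ • m - A v) := by
      rw [smul_sub, smul_smul, mul_inv_cancel₀ hd0.ne', one_smul]
    rw [e, norm_smul, Real.norm_of_nonneg hd0.le]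
    have := mul_le_mul_of_nonneg_left h hd0.le
    linarith
  have hmn : ‖m‖ ≤ 21 / 20 * d := by
    have := (hq ⟨v, hv⟩).2.2.2.2.2
    rwa [dist_eq_norm] at this
  -- `⟪p - y, m⟫ ≥ 3 d r / 20`
  have hinner : 3 / 20 * d * r ≤ ⟪p - y, m⟫ := by
    have h1 : ⟪p - y, m⟫ = d * ⟪p - y, A v⟫ + ⟪p - y, m - d • A v⟫ := by
      calc ⟪p - y, m⟫ = ⟪p - y, d • A v + (m - d • A v)⟫ := by rw [add_sub_cancel]
        _ = d * ⟪p - y, A v⟫ + ⟪p - y, m - d • A v⟫ := by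
          rw [inner_add_right, real_inner_smul_right]
    have h2 : |⟪p - y, m - d • A v⟫| ≤ ‖p - y‖ * ‖m - d • A v‖ := abs_real_inner_le_norm _ _
    rw [abs_le] at h2
    have h3 : ‖p - y‖ * ‖m - d • A v‖ ≤ r * (d / 20) := by
      rw [hr']; exact mul_le_mul_of_nonneg_left hmA (by rw [← hr']; exact norm_nonneg _)
    rw [hr'] at hcov
    have h4 : d * (r / 5) ≤ d * ⟪p - y, A v⟫ := mul_le_mul_of_nonneg_left (by linarith) hd0.le
    nlinarith
  -- expand `‖p - q v‖²`
  have hexp : ‖p - q ⟨v, hv⟩‖ ^ 2 = r ^ 2 - 2 * ⟪p - y, m⟫ + ‖m‖ ^ 2 := by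
    have e : p - q ⟨v, hv⟩ = (p - y) - m := by rw [hm]; abel
    rw [e, norm_sub_sq_real, hr']
  have hlt : ‖p - q ⟨v, hv⟩‖ ^ 2 < r ^ 2 := by
    rw [hexp]
    have hm2 : ‖m‖ ^ 2 ≤ (21 / 20 * d) ^ 2 := pow_le_pow_left₀ (norm_nonneg _) hmn 2
    nlinarith
  have hr0 : 0 ≤ r := dist_nonneg
  rw [dist_comm, dist_eq_norm]
  exact lt_of_pow_lt_pow_left₀ 2 hr0 hlt

/-- **Relative denseness of everywhere-good sets.** A non-empty `δ`-separated `S ⊆ ℝ³` all of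
whose points are `PatternGood` (fcc or hcp) with scale `≤ R₀` has a point within `4 R₀` of every
point of `ℝ³`: the closest point of `S` to `p` (it exists by local finiteness) cannot be farther,
by `hge_exists_closer`. [folklore] -/
theorem hge_relDense {S : Set (EuclideanSpace ℝ (Fin 3))} {δ R₀ : ℝ} (hδ : 0 < δ)
    (hsep : ∀ p ∈ S, ∀ q ∈ S, p ≠ q → δ ≤ dist p q) (hne : S.Nonempty)
    (hgood : ∀ y ∈ S, PatternGood fccKissingPattern R₀ S y ∨ PatternGood hcpKissingPattern R₀ S y) :
    ∃ R₁ : ℝ, ∀ p : (EuclideanSpace ℝ (Fin 3)), ∃ y ∈ S, dist y p ≤ R₁ := by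
  classical
  obtain ⟨⟨hf1, hfne⟩, ⟨hh1, hhne⟩⟩ := hge_patterns_unit_nonempty
  refine ⟨4 * R₀, fun p => ?_⟩
  obtain ⟨y₀, hy₀⟩ := hne
  -- the closest point of `S` to `p`
  have hfin : (S ∩ closedBall p (dist y₀ p)).Finite :=
    finite_of_forall_le_dist_of_subset_closedBall hδ
      (fun a ha b hb hab => hsep a ha.1 b hb.1 hab) Set.inter_subset_right
  have hmem : y₀ ∈ hfin.toFinset := by simpa using hy₀
  obtain ⟨y, hy, hmin⟩ := Finset.exists_min_image hfin.toFinset (fun y => dist y p) ⟨y₀, hmem⟩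
  simp only [Set.Finite.mem_toFinset, Set.mem_inter_iff, mem_closedBall] at hy hmin
  refine ⟨y, hy.1, ?_⟩
  by_contra hfar
  rw [not_le] at hfar
  obtain ⟨z, hz, hzlt⟩ : ∃ z ∈ S, dist z p < dist y p := by
    rcases hgood y hy.1 with h | h
    · exact hge_exists_closer hf1 hfne hge_fcc_cover hδ hsep hy.1 h hfar
    · exact hge_exists_closer hh1 hhne hge_hcp_cover hδ hsep hy.1 h hfar
  have := hmin z ⟨hz, hzlt.le.trans hy.2⟩
  linarith

end Summit.AtomisticToContinuum.Crystallization.Theorems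

end
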